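import Summits.Ventures.LatticeQCDFlow.Scaling.LadderPoincare
import Literature.Probability.MarkovChains.MarkovChainDecomposition
import Literature.Probability.MarkovChains.AsymptoticVarianceSpectral

/-!
HONEST FRAMING: exact (Metropolis-corrected) sampling algorithms for lattice gauge theory; figures
of merit are autocorrelation/cost numbers at stated couplings and volumes; no continuum-physics
claim.

# LadderDecomposition — THE GENERIC LADDER DECOMPOSITION BOUND: a finite reversible chain fibred over the
# ladder `0,…,K` with equal block masses `1/(K+1)`, adjacent block flows `≥ c`, restriction Poincaré constant
# `λ_min` and escape probability `≤ γ_e` has `Gap ≥ min{λ̄/3, λ̄λ_min/(3γ_e + λ̄)}` with `λ̄ = 2c/(K+1)`, and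
# `asympVar(g) ≤ (2/that − 1)·Var(g)` for EVERY observable (lean-2 GEN-16, ours)

Venture-side (OURS).  Cell `lqcd-flow` (pub-lqcd), unit `pub-lqcd-lean-2-g16`, 2026-08-24.  The abstract core
of chapter X (`Scaling/SimulatedTemperingFinite*`, `Scaling/ReplicaExchangeFinite*`) for ANY finite reversible
chain `P` with a block map `blk : X → Fin (K+1)` (a "ladder" of `K+1` blocks), in the vocabulary of the
Literature's Jerrum–Son–Tetali–Vigoda file (`blockMass`, `blockFlow`, `blockLaw`, `restrictionChain`,
`projectionChain`, `escapeProb`; all PROVED there).  Flows are absolute, `blockFlow i j = Σ_{x∈Ω_i, y∈Ω_j}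
π(x)P(x,y) = π̄(i)P̄(i,j)`; the Dirichlet form of the projection chain dominates `c·Σ_k (g(k+1) − g(k))²` when
every adjacent flow is `≥ c`, and the ladder Poincaré inequality of `Scaling/LadderPoincare`
(`Var_unif ≤ ((K+1)/2)·Σ(Δg)²`) turns this into the Poincaré constant `λ̄ = 2c/(K+1)` for the uniform block law.

* **`ladder_projection_poincare`** — `(2c/(K+1))·Var_π̄(g) ≤ 𝓔_π̄(P̄; g)`;
* **`ladder_spectralGap_ge`** — `min{λ̄/3, λ̄λ_min/(3γ_e + λ̄)} ≤ Gap(P)`, `λ̄ = 2c/(K+1)` (JSTV Theorem 1; the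
  block map is onto because every block has positive mass);
* **`ladder_asympVar_le`** — `P` irreducible ⇒ `asympVar g π P ≤ (2/min{…} − 1)·Var_π(g)` for every `g`
  (Madras–Slade sandwich), i.e. `τ_int(g) ≤ 1/min{…} − ½`.

Instances: simulated tempering (`blockFlow(k,k+1) = t·ov_k/(2(K+1))`, `c = ta/(2(K+1))`, `λ̄ = ta/(K+1)²`,
`Scaling/SimulatedTemperingFiniteGap`); replica exchange (`c = t·acc/(K(K+1))`, `λ̄ = 2ta/(K(K+1)²)`,
`Scaling/ReplicaExchangeFiniteGap`); any other ladder sampler of the cell (tempering in the boundary condition or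
in the mass, umbrella ladders) once its four block quantities are computed.  NOT CLAIMED: sharp constants;
anything measured.  Literature grade (cell rule): KNOWN MECHANISM (JSTV 2004 Thm 1; path Poincaré), NEW TYPING;
nothing cited as a fact; no new bib keys.
-/

noncomputable section

open Finset
open Literature.Probability.MarkovChains
open Literature.Probability.MarkovChains.Decomposition

namespace Summit.Ventures.LatticeQCDFlow.Scaling

variable {X : Type*} [Fintype X] [DecidableEq X] {K : ℕ} {π : X → ℝ} {P : Matrix X X ℝ}
  {blk : X → Fin (K + 1)}

omit [DecidableEq X] in
/-- **Poincaré inequality for the projection chain of a ladder:** equal block masses `1/(K+1)` and adjacent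
flows `≥ c ≥ 0` in both directions (all flows `≥ 0`) give `(2c/(K+1))·Var_π̄(g) ≤ 𝓔_π̄(P̄; g)`. [ours] -/
theorem ladder_projection_poincare (hmass : ∀ i, blockMass π blk i = 1 / (K + 1))
    (hF0 : ∀ i j, 0 ≤ blockFlow π P blk i j) {c : ℝ} (hc : 0 ≤ c)
    (hup : ∀ j : Fin K, c ≤ blockFlow π P blk j.castSucc j.succ)
    (hdown : ∀ j : Fin K, c ≤ blockFlow π P blk j.succ j.castSucc) (g : Fin (K + 1) → ℝ) :
    2 * c / (K + 1) * lawVariance (blockMass π blk) g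
      ≤ dirichletForm (blockMass π blk) (projectionChain π P blk) g := by
  have hM : ∀ i, blockMass π blk i ≠ 0 := fun i => by rw [hmass]; positivity
  have hunif : blockMass π blk = fun _ => (1 : ℝ) / (K + 1) := funext hmass
  -- termwise domination of the flow by the adjacent indicator
  have hterm : ∀ i j : Fin (K + 1),
      c * ((if j.val = i.val + 1 then (g i - g j) ^ 2 else 0) + (if i.val = j.val + 1 then (g i - g j) ^ 2 else 0))
        ≤ blockFlow π P blk i j * (g i - g j) ^ 2 := by
    intro i j
    by_cases h1 : j.val = i.val + 1
    · have hj : i.val < K := by have := j.2; omega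
      set k : Fin K := ⟨i.val, hj⟩ with hk
      have e1 : i = k.castSucc := Fin.ext (by simp [hk])
      have e2 : j = k.succ := Fin.ext (by simp [hk]; omega)
      rw [if_pos h1, if_neg (by omega), add_zero]
      refine mul_le_mul_of_nonneg_right ?_ (sq_nonneg _)
      rw [e1, e2]; exact hup k
    by_cases h2 : i.val = j.val + 1
    · have hj : j.val < K := by have := i.2; omega
      set k : Fin K := ⟨j.val, hj⟩ with hk
      have e1 : j = k.castSucc := Fin.ext (by simp [hk])
      have e2 : i = k.succ := Fin.ext (by simp [hk]; omega)
      rw [if_neg h1, if_pos h2, zero_add]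
      refine mul_le_mul_of_nonneg_right ?_ (sq_nonneg _)
      rw [e1, e2]; exact hdown k
    · rw [if_neg h1, if_neg h2, add_zero, mul_zero]
      exact mul_nonneg (hF0 i j) (sq_nonneg _)
  have hE : c * ∑ k : Fin K, (g k.succ - g k.castSucc) ^ 2
      ≤ dirichletForm (blockMass π blk) (projectionChain π P blk) g := by
    unfold dirichletForm
    simp_rw [blockMass_mul_projectionChain (hM _)]
    have hsum := Finset.sum_le_sum fun i (_ : i ∈ (univ : Finset (Fin (K + 1)))) =>
      Finset.sum_le_sum fun j (_ : j ∈ (univ : Finset (Fin (K + 1)))) => hterm i j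
    have hL : ∑ i : Fin (K + 1), ∑ j : Fin (K + 1), c
        * ((if j.val = i.val + 1 then (g i - g j) ^ 2 else 0) + (if i.val = j.val + 1 then (g i - g j) ^ 2 else 0))
        = c * (2 * ∑ k : Fin K, (g k.succ - g k.castSucc) ^ 2) := by
      simp_rw [← Finset.mul_sum, Finset.sum_add_distrib]
      rw [sum_sum_ite_val_succ (fun i j => (g i - g j) ^ 2), sum_sum_ite_val_pred (fun i j => (g i - g j) ^ 2)]
      congr 1
      rw [two_mul]
      congr 1
      exact sum_congr rfl fun k _ => by ring
    rw [hL] at hsum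
    have e : c * ∑ k : Fin K, (g k.succ - g k.castSucc) ^ 2
        = 1 / 2 * (c * (2 * ∑ k : Fin K, (g k.succ - g k.castSucc) ^ 2)) := by ring
    rw [e]
    exact mul_le_mul_of_nonneg_left hsum (by norm_num)
  have hvar := lawVariance_uniform_le_ladder K g
  rw [← hunif] at hvar
  refine le_trans ?_ hE
  calc 2 * c / (K + 1) * lawVariance (blockMass π blk) g
      ≤ 2 * c / (K + 1) * (((K + 1 : ℝ) / 2) * ∑ k : Fin K, (g k.succ - g k.castSucc) ^ 2) :=
        mul_le_mul_of_nonneg_left hvar (by positivity)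
    _ = c * ∑ k : Fin K, (g k.succ - g k.castSucc) ^ 2 := by
        field_simp

/-- **THE LADDER DECOMPOSITION BOUND ON THE SPECTRAL GAP** (Jerrum–Son–Tetali–Vigoda Theorem 1 along a ladder):
positive probability vector `π`, row-stochastic `π`-reversible `P`, block masses `1/(K+1)`, adjacent flows `≥ c > 0`,
restriction Poincaré constant `λ_min > 0`, escape probabilities `≤ γ_e`, `K ≥ 1` ⇒ with `λ̄ = 2c/(K+1)`:
`min{λ̄/3, λ̄λ_min/(3γ_e + λ̄)} ≤ Gap(P)`. [ours] -/
theorem ladder_spectralGap_ge [Nontrivial X] (hπ : ∀ x, 0 < π x) (hπ1 : ∑ x, π x = 1)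
    (hP : IsRowStochastic P) (hDB : DetailedBalance π P) (hmass : ∀ i, blockMass π blk i = 1 / (K + 1))
    {c lamMin γe : ℝ} (hc : 0 < c) (hlamMin : 0 < lamMin) (hγe : 0 ≤ γe)
    (hup : ∀ j : Fin K, c ≤ blockFlow π P blk j.castSucc j.succ)
    (hdown : ∀ j : Fin K, c ≤ blockFlow π P blk j.succ j.castSucc)
    (hres : ∀ i, ∀ f : X → ℝ, lamMin * lawVariance (blockLaw π blk i) f
      ≤ dirichletForm (blockLaw π blk i) (restrictionChain P blk) f)
    (hesc : ∀ x, escapeProb P blk x ≤ γe) :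
    min (2 * c / (K + 1) / 3) (2 * c / (K + 1) * lamMin / (3 * γe + 2 * c / (K + 1))) ≤ spectralGap π P := by
  have hsurj : Function.Surjective blk := by
    intro i
    by_contra h
    push Not at h
    have : blockMass π blk i = 0 := by
      unfold blockMass
      exact Finset.sum_eq_zero fun x hx => absurd (mem_block.mp hx) (h x)
    rw [hmass] at this
    exact absurd this (by positivity)
  exact JerrumEtAl2004_thm_1_spectralGap hπ hπ1 hP hDB hsurj (by positivity) hlamMin hγe
    (ladder_projection_poincare hmass (blockFlow_nonneg (fun x => (hπ x).le) hP.1 blk) hc.le hup hdown)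
    hres hesc

/-- **THE LADDER CEILING ON THE ASYMPTOTIC VARIANCE OF EVERY OBSERVABLE:** under the hypotheses of
`ladder_spectralGap_ge` and irreducibility, `asympVar g π P ≤ (2/min{λ̄/3, λ̄λ_min/(3γ_e + λ̄)} − 1)·Var_π(g)`
(Madras–Slade sandwich). [ours] -/
theorem ladder_asympVar_le [Nontrivial X] (hπ : ∀ x, 0 < π x) (hπ1 : ∑ x, π x = 1)
    (hP : IsRowStochastic P) (hDB : DetailedBalance π P) (hirr : IsIrreducible P)
    (hmass : ∀ i, blockMass π blk i = 1 / (K + 1))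
    {c lamMin γe : ℝ} (hc : 0 < c) (hlamMin : 0 < lamMin) (hγe : 0 ≤ γe)
    (hup : ∀ j : Fin K, c ≤ blockFlow π P blk j.castSucc j.succ)
    (hdown : ∀ j : Fin K, c ≤ blockFlow π P blk j.succ j.castSucc)
    (hres : ∀ i, ∀ f : X → ℝ, lamMin * lawVariance (blockLaw π blk i) f
      ≤ dirichletForm (blockLaw π blk i) (restrictionChain P blk) f)
    (hesc : ∀ x, escapeProb P blk x ≤ γe) (g : X → ℝ) :
    asympVar g π P
      ≤ (2 / min (2 * c / (K + 1) / 3) (2 * c / (K + 1) * lamMin / (3 * γe + 2 * c / (K + 1))) - 1)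
          * lawVariance π g := by
  have h1 := asympVar_le_spectralGap hπ hπ1 hP hDB hirr g
  have hgap := ladder_spectralGap_ge hπ hπ1 hP hDB hmass hc hlamMin hγe hup hdown hres hesc
  have hcpos : 0 < min (2 * c / (K + 1) / 3) (2 * c / (K + 1) * lamMin / (3 * γe + 2 * c / (K + 1))) :=
    lt_min (by positivity) (by positivity)
  refine h1.trans (mul_le_mul_of_nonneg_right ?_ (lawVariance_nonneg (fun x => (hπ x).le) g))
  have := div_le_div_of_nonneg_left (by norm_num : (0 : ℝ) ≤ 2) hcpos hgap
  linarith

end Summit.Ventures.LatticeQCDFlow.Scaling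

end
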